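import Summits.QuantumFields.BalabanUV.Beta.EriceRemainderEnclosureHistoryAutonomyComparisonAgeCompositionEnteringLagLevels

/-!
# EriceRemainderEnclosureHistoryAutonomyComparisonAgeCompositionEnteringLagLevelsSup — (E87e) route (N), first order: THE STATIC FAMILY (S-h) WITH THE GROWTH
# CHAIN REPLACED BY THE SUP BOUND OF THE OLDER SURPLUS — the family (S-h♯): for a truncation input the older surplus `v` lies in `[vlo, 1]` below the
# edge (`vlo = 1 −` the aggregate older row mass), so the entering lag reads at most `Σ_l [edge]·Ky` (no product of growth factors at all) and every
# lower mass on the right is at least `vlo(n+2)` times its static value — a k-UNIFORM family where (S-h)∕(S-h♭) carry `Π Hg` over up to `k₃+k₂` pins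

Cell `pub-balaban`, β-function sub-cell, BINDER row D4 «RemainderConst leaves for Bałaban's split» (`HOME/BINDER-OWNERS.md`; owner lineage `b2b-balaban-beta-an4`;
this file by co-owner #2 lineage `b2b-balaban-beta-d4-p2`, generation 78), β-FLOW TEAM duty (1), FREEZE (0) honoured (def-free; imports (E86c); uses (E86c)
`mono_chain` ∕ `sol_support` ∕ `sol_lower`, (E83a) `read_succ_onelag`, (E71a) `sol_nonneg_le_of_supersol` ∕ `read_nonneg` BY NAME; nothing restated).

HONEST FRAMING (page 1, verbatim and binding).  *"Discharging BetaPertH makes Bałaban's UV stability UNCONDITIONAL — a real constructive-QFT result; it is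
NOT the continuum limit and NOT the Clay problem."*  THIS FILE DISCHARGES NOTHING OF THE KIND.  Elementary real analysis about ABSTRACT non-negative window
kernels and the FIRST-ORDER renewal objects of route (N); the objects it will serve are built on the cell's own NOT-IN-PRINT binders (the age profile of
Bałaban's (1.22) limit functional is NOT PRINTED — [I] p. 298; GAPS G-t4-U2-1∕-2) and NOT asserted.  Row D4 class UNCHANGED (critical-path width 0; instance
0∕1; D4 DISCHARGE NO DATE).  HONEST DEPENDENCY: continuum YM on T⁴ ⇐ BetaPertH ∧ nine spine estimates (0/9 proved); BetaPertH ⇐ (D1) ∧ (D4) ∧ CAP+tail;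
G-an2-4 gates asym, D1 and NE2/3/4.

THE POINT (census sense (α); route (N); README `HOME/b2b-balaban-beta-d4-p2/g78/e87/README.md` §2).  In (E86c) `old_read_antitone_of_decay_defect` (and (E87a)'s
(S-h♭)) the young drop read by the entering lag, `d(n+1+yo) = Σ_l Ky (n+1+yo) l·t(n+2+yo+l)`, is bounded through the GROWTH CHAIN `t ≤ v ≤ Π_s H_s·v(n+2)`
— up to `yo + y` factors `Hg ≥ 1`, each the per-pin sup of the older surplus's growth; over a long window this compounds to `exp(Σ_s(θ·ω̃ + KL(s,0)))` while the
surplus of a TRUNCATION never exceeds `1` and, below the edge, never drops below `1 −` (the aggregate older row mass).  §1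
**`old_read_antitone_of_decay_defect_sup`**: the same conclusion (the old reads of the young drops non-increasing in the pin) for an input `v` with `0 ≤ v ≤ 1`,
supported on `[0,j]`, non-decreasing below the edge, and `vlo p ≤ v p` for `p ≤ j` (any displayed minorant `vlo`), from the family **(S-h♯)** at the pins
`n+1+yo ≤ j`:  `Ko (n+1)(yo−1)·Σ_{l<y} [n+2+yo+l ≤ j]·Ky (n+1+yo) l ≤ vlo(n+2)·((1−σo_n)·Σ_{l'<yo} Ko n l'·A(n+1+l') + σo_n·Ko n 0·A(n+1))` — NO growth
factor anywhere (no `H`, no `hgrow` among the hypotheses); product form, so no sign condition on `vlo`.  NUMERICS OF RECORD (`g78/numerics/sh3.py`, `sh4.py`;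
benchmark three-age flows, 8 regimes, classes one∕self∕lower∕adversarial-relaxed, `vlo = 1 − x̃_{k₃}`): log-ratio of (S-h♯) at its worst truncation
`−0.59∕−0.56∕−0.55∕−0.53` (class lower, `k₃ = 8∕16∕32∕64`), `−0.66 … −0.61` (one), `−0.60 … −0.55` (self), `−0.57 … −0.53` (adversarial-relaxed) — k-UNIFORM —
where (S-h♭) reads `−0.48∕−0.42∕−0.33∕−0.27` (lower) and `−0.23∕−0.22` at `k₃ = 96∕128` (kit j335177).  NOT CLAIMED: (S-h♯) along flows (its damping-free
decoupled form is `−0.43∕−0.39∕−0.29∕−0.22` on the benchmark, `k₃ ≤ 64` — README §3); anything nonlinear; anything printed — NOT B12 Thm 2, NOT BetaPertH.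

WHAT IS PROVED ([folklore]; 0 `def`, 0 sorry).  §1 **`old_read_antitone_of_decay_defect_sup`**.
v1.1 (same generation) APPENDS §2 **`trunc_surplus_bounds`** — the surplus `v = 1_{[0,j]} − R v` of a truncation under a non-negative kernel, if
non-negative, satisfies `v ≤ 1` everywhere and `v p ≥ 1 − Σ_l K p l` at the pins `p ≤ j` (the minorant `vlo` the induction feeds to §1) — and modifies NO
existing declaration.
-/
noncomputable section
open Finset

namespace Summit.QuantumFields.BalabanUV.Beta.EriceRemainderEnclosureHistoryAutonomyComparisonAgeCompositionEnteringLagLevelsSup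

open Summit.QuantumFields.BalabanUV.Beta.EriceRemainderEnclosureHistoryAutonomyComparisonAgeComposition
open Summit.QuantumFields.BalabanUV.Beta.EriceRemainderEnclosureHistoryAutonomyComparisonAgeCompositionEnteringLag (read_succ_onelag)
open Summit.QuantumFields.BalabanUV.Beta.EriceRemainderEnclosureHistoryAutonomyComparisonAgeCompositionEnteringLagLevels (mono_chain sol_support sol_lower)

variable {N y : ℕ}

/-! ## §1 (S-h♯): the sup bound of the older surplus instead of its growth chain -/

/-- **(MONO) FOR A PAIR OF MULTI-LAG AGES FROM DECAY AND DEFECT — THE SUP-BOUND FAMILY (S-h♯).**  Young kernel `Ky ≥ 0` with `y ≥ 1` lags, reads `Ry`;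
input `v` with `0 ≤ v ≤ 1`, supported on `[0,j]`, non-decreasing below the edge, and bounded BELOW by a displayed `vlo` at the pins `p ≤ j`; KEY ratio
`ρ ≤ 1`; young solution `t` (`t = v − Ry t`, zero tail), young lower masses `A p = Σ_{l<y} [p+1+l ≤ j]·Ky p l·(1−ρ(p+1+l))`; old window kernel `Ko ≥ 0`
with `yo ≥ 1` lags, reads `Ro`, one-lag structure `σo ∈ [0,1]`.  IF **(S-h♯)** holds at the pins `n+1+yo ≤ j`:
`Ko (n+1)(yo−1)·Σ_{l<y} [n+2+yo+l ≤ j]·Ky (n+1+yo) l ≤ vlo(n+2)·((1−σo_n)·Σ_{l'<yo} Ko n l'·A(n+1+l') + σo_n·Ko n 0·A(n+1))`,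
THEN `Ro (Ry t) (n+1) ≤ Ro (Ry t) n` at every pin.  (The entering lag reads `t ≤ v ≤ 1` lag by lag below the edge and `0` beyond it; every old lag reads a
young drop `≥ A·v ≥ A·v(n+2) ≥ A·vlo(n+2)` by monotonicity below the edge; the rest is (E86c)'s entering-lag identity.) [folklore] -/
theorem old_read_antitone_of_decay_defect_sup
    {Ky : ℕ → ℕ → ℝ} {Ry : (ℕ → ℝ) → ℕ → ℝ}
    (hRy : ∀ v n, Ry v n = ∑ l ∈ range N, Ky n l * v (n + 1 + l)) (hKy : ∀ n l, 0 ≤ Ky n l) (hKyy : ∀ n l, y ≤ l → Ky n l = 0) (hyN : y ≤ N)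
    {yo : ℕ} {Ko : ℕ → ℕ → ℝ} {Ro : (ℕ → ℝ) → ℕ → ℝ} {σo : ℕ → ℝ}
    (hRo : ∀ v n, Ro v n = ∑ l ∈ range N, Ko n l * v (n + 1 + l)) (hKo : ∀ n l, 0 ≤ Ko n l) (hKoy : ∀ n l, yo ≤ l → Ko n l = 0)
    (hyo : 1 ≤ yo) (hyoN : yo ≤ N)
    (hσo : ∀ n l, l + 1 < yo → Ko (n + 1) l = σo n * Ko n (l + 1)) (hσo01 : ∀ n, 0 ≤ σo n ∧ σo n ≤ 1)
    {v : ℕ → ℝ} {j : ℕ} (hv0 : ∀ n, 0 ≤ v n) (hv1 : ∀ n, v n ≤ 1) (hvj : ∀ n, j < n → v n = 0) (hmono : ∀ m, m < j → v m ≤ v (m + 1))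
    {vlo : ℕ → ℝ} (hvlo : ∀ p, p ≤ j → vlo p ≤ v p)
    {ρ : ℕ → ℝ} (hkey : ∀ n, Ry v n ≤ ρ n * v n) (hρ1 : ∀ n, ρ n ≤ 1)
    {t : ℕ → ℝ} (htail : ∀ n, N < n → t n = 0) (hrec : ∀ n, t n = v n - Ry t n)
    {A : ℕ → ℝ} (hA : ∀ p, A p = ∑ l ∈ range y, if p + 1 + l ≤ j then Ky p l * (1 - ρ (p + 1 + l)) else 0)
    (hSh : ∀ n, n + 1 + yo ≤ j →
      Ko (n + 1) (yo - 1) * ∑ l ∈ range y, (if n + 2 + yo + l ≤ j then Ky (n + 1 + yo) l else 0) ≤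
        vlo (n + 2) * ((1 - σo n) * ∑ l' ∈ range yo, Ko n l' * A (n + 1 + l') + σo n * (Ko n 0 * A (n + 1)))) :
    ∀ n, Ro (Ry t) (n + 1) ≤ Ro (Ry t) n := by
  have hsup : ∀ n, Ry v n ≤ v n := fun n => (hkey n).trans (by nlinarith [hρ1 n, hv0 n])
  have htv := sol_nonneg_le_of_supersol hRy hKy hv0 hsup htail hrec
  have ht0 := sol_support hvj htv
  have htlow := sol_lower hRy hKy hkey htv hrec
  -- the young drops: signs, support, the static sandwich
  set d : ℕ → ℝ := Ry t with hd
  have hd0 : ∀ p, 0 ≤ d p := fun p => read_nonneg hRy hKy fun m _ => (htv m).1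
  have hdz : ∀ p, j < p + 1 → d p = 0 := fun p hp => by
    rw [hd, hRy]; exact sum_eq_zero fun l _ => by rw [ht0 _ (by omega), mul_zero]
  have hA0 : ∀ p, 0 ≤ A p := fun p => by
    rw [hA]; exact sum_nonneg fun l _ => by split_ifs <;> nlinarith [hKy p l, hρ1 (p + 1 + l)]
  have hdlow : ∀ p, A p * v (p + 1) ≤ d p := by
    intro p
    rw [hA, hd, hRy, sum_mul]
    have hsub : ∑ l ∈ range y, Ky p l * t (p + 1 + l) ≤ ∑ l ∈ range N, Ky p l * t (p + 1 + l) :=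
      sum_le_sum_of_subset_of_nonneg (range_subset_range.mpr hyN) fun l _ _ => mul_nonneg (hKy p l) (htv _).1
    refine le_trans (sum_le_sum fun l hl => ?_) hsub
    split_ifs with hpl
    · have hv1 : v (p + 1) ≤ v (p + 1 + l) := mono_chain hmono l (p + 1) (by omega)
      have hρl : 0 ≤ 1 - ρ (p + 1 + l) := by linarith [hρ1 (p + 1 + l)]
      calc Ky p l * (1 - ρ (p + 1 + l)) * v (p + 1) ≤ Ky p l * ((1 - ρ (p + 1 + l)) * v (p + 1 + l)) := by
            rw [mul_assoc]; exact mul_le_mul_of_nonneg_left (mul_le_mul_of_nonneg_left hv1 hρl) (hKy p l)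
        _ ≤ Ky p l * t (p + 1 + l) := mul_le_mul_of_nonneg_left (htlow _) (hKy p l)
    · rw [zero_mul]; exact mul_nonneg (hKy p l) (htv _).1
  have hdup : ∀ n, d (n + 1 + yo) ≤ ∑ l ∈ range y, (if n + 2 + yo + l ≤ j then Ky (n + 1 + yo) l else 0) := by
    intro n
    rw [hd, hRy]
    have heq : ∑ l ∈ range N, Ky (n + 1 + yo) l * t (n + 1 + yo + 1 + l) = ∑ l ∈ range y, Ky (n + 1 + yo) l * t (n + 1 + yo + 1 + l) :=
      (sum_subset (range_subset_range.mpr hyN) fun l _ hly => by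
        rw [hKyy _ l (by rw [mem_range, not_lt] at hly; exact hly), zero_mul]).symm
    rw [heq]
    refine sum_le_sum fun l _ => ?_
    split_ifs with hlj
    · -- below the edge the young solution is at most `v ≤ 1`
      have h1 : t (n + 1 + yo + 1 + l) ≤ 1 := (htv _).2.trans (hv1 _)
      nlinarith [hKy (n + 1 + yo) l, h1]
    · -- beyond the edge the young solution vanishes
      rw [ht0 _ (by omega), mul_zero]
  -- the old kernel reading the young drops: identity, leaving term, criterion
  intro n
  have hid := read_succ_onelag hRo hKoy hyo hyoN hσo d n
  have hlead : Ko n 0 * d (n + 1) ≤ Ro d n := by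
    rw [hRo]
    have h := single_le_sum (f := fun l => Ko n l * d (n + 1 + l)) (fun l _ => mul_nonneg (hKo n l) (hd0 _)) (mem_range.mpr (by omega : 0 < N))
    simpa using h
  have hcrit : Ko (n + 1) (yo - 1) * d (n + 1 + yo) ≤ (1 - σo n) * Ro d n + σo n * (Ko n 0 * d (n + 1)) → Ro d (n + 1) ≤ Ro d n := by
    intro h
    have e1 : σo n * (Ro d n - Ko n 0 * d (n + 1)) = σo n * Ro d n - σo n * (Ko n 0 * d (n + 1)) := by ring
    have e2 : (1 - σo n) * Ro d n = Ro d n - σo n * Ro d n := by ring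
    rw [hid]; linarith
  by_cases hedge : j < n + 1 + yo
  · -- free: the young drops vanish beyond the edge
    refine hcrit ?_
    rw [hdz _ (by omega), mul_zero]
    have h1 : 0 ≤ (1 - σo n) * Ro d n := mul_nonneg (by linarith [(hσo01 n).2]) (by linarith [mul_nonneg (hKo n 0) (hd0 (n + 1))])
    have h2 : 0 ≤ σo n * (Ko n 0 * d (n + 1)) := mul_nonneg (hσo01 n).1 (mul_nonneg (hKo n 0) (hd0 _))
    linarith
  · have hnj : n + 1 + yo ≤ j := by omega
    refine hcrit ?_
    -- lower: every old lag reads a young drop at least `A · v`, and `v` there is at least `v (n+2)` (below the edge)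
    have hlow : (∑ l' ∈ range yo, Ko n l' * A (n + 1 + l')) * v (n + 2) ≤ Ro d n := by
      rw [hRo, sum_mul]
      have hsub : ∑ l ∈ range yo, Ko n l * d (n + 1 + l) ≤ ∑ l ∈ range N, Ko n l * d (n + 1 + l) :=
        sum_le_sum_of_subset_of_nonneg (range_subset_range.mpr hyoN) fun l _ _ => mul_nonneg (hKo n l) (hd0 _)
      refine le_trans (sum_le_sum fun l hl => ?_) hsub
      have hly := mem_range.mp hl
      have hv2 : v (n + 2) ≤ v (n + 1 + l + 1) := by
        have h := mono_chain hmono l (n + 2) (by omega); rwa [show n + 2 + l = n + 1 + l + 1 by ring] at h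
      calc Ko n l * A (n + 1 + l) * v (n + 2) ≤ Ko n l * (A (n + 1 + l) * v (n + 1 + l + 1)) := by
            rw [mul_assoc]; exact mul_le_mul_of_nonneg_left (mul_le_mul_of_nonneg_left hv2 (hA0 _)) (hKo n l)
        _ ≤ Ko n l * d (n + 1 + l) := mul_le_mul_of_nonneg_left (hdlow _) (hKo n l)
    have hlow0 : Ko n 0 * (A (n + 1) * v (n + 2)) ≤ Ko n 0 * d (n + 1) := by
      have h := hdlow (n + 1); rw [show n + 1 + 1 = n + 2 by ring] at h
      exact mul_le_mul_of_nonneg_left h (hKo n 0)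
    have hRA0 : 0 ≤ (1 - σo n) * ∑ l' ∈ range yo, Ko n l' * A (n + 1 + l') + σo n * (Ko n 0 * A (n + 1)) := by
      have hs0 : 0 ≤ ∑ l' ∈ range yo, Ko n l' * A (n + 1 + l') := sum_nonneg fun l' _ => mul_nonneg (hKo n l') (hA0 _)
      have := mul_nonneg (by linarith [(hσo01 n).2] : (0:ℝ) ≤ 1 - σo n) hs0
      have := mul_nonneg (hσo01 n).1 (mul_nonneg (hKo n 0) (hA0 (n + 1)))
      linarith
    -- entering term ≤ static young row ≤ vlo(n+2)·(static right side) ≤ v(n+2)·(static right side)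
    have h1 : Ko (n + 1) (yo - 1) * d (n + 1 + yo) ≤ Ko (n + 1) (yo - 1) * ∑ l ∈ range y, (if n + 2 + yo + l ≤ j then Ky (n + 1 + yo) l else 0) :=
      mul_le_mul_of_nonneg_left (hdup n) (hKo _ _)
    have h4 : Ko (n + 1) (yo - 1) * d (n + 1 + yo) ≤
        v (n + 2) * ((1 - σo n) * ∑ l' ∈ range yo, Ko n l' * A (n + 1 + l') + σo n * (Ko n 0 * A (n + 1))) :=
      (h1.trans (hSh n hnj)).trans (mul_le_mul_of_nonneg_right (hvlo (n + 2) (by omega)) hRA0)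
    have h2 : (1 - σo n) * ((∑ l' ∈ range yo, Ko n l' * A (n + 1 + l')) * v (n + 2)) ≤ (1 - σo n) * Ro d n :=
      mul_le_mul_of_nonneg_left hlow (by linarith [(hσo01 n).2])
    have h3 : σo n * (Ko n 0 * (A (n + 1) * v (n + 2))) ≤ σo n * (Ko n 0 * d (n + 1)) := mul_le_mul_of_nonneg_left hlow0 (hσo01 n).1
    have e2 : v (n + 2) * ((1 - σo n) * ∑ l' ∈ range yo, Ko n l' * A (n + 1 + l') + σo n * (Ko n 0 * A (n + 1))) =
        (1 - σo n) * ((∑ l' ∈ range yo, Ko n l' * A (n + 1 + l')) * v (n + 2)) + σo n * (Ko n 0 * (A (n + 1) * v (n + 2))) := by ring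
    linarith

/-! ## §2 (APPEND, same generation) The truncation surplus lies in `[1 − aggregate row mass, 1]` below the edge -/

/-- **THE SURPLUS OF A TRUNCATION: SUP BOUND AND MINORANT.**  A non-negative kernel `K` with reads `R`; `v` the surplus of the truncation at `j`,
`v n = 1_{[n ≤ j]} − R v n`, with `v ≥ 0`.  Then `v ≤ 1` at every pin (reads of a non-negative sequence are non-negative) and, at the pins `p ≤ j`,
`1 − Σ_{l<N} K p l ≤ v p` (reads of a sequence `≤ 1` are at most the row mass). [folklore] -/
theorem trunc_surplus_bounds {K : ℕ → ℕ → ℝ} {R : (ℕ → ℝ) → ℕ → ℝ}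
    (hR : ∀ v n, R v n = ∑ l ∈ range N, K n l * v (n + 1 + l)) (hK : ∀ n l, 0 ≤ K n l) {v : ℕ → ℝ} {j : ℕ}
    (hv0 : ∀ n, 0 ≤ v n) (hrec : ∀ n, v n = (if n ≤ j then (1:ℝ) else 0) - R v n) :
    (∀ n, v n ≤ 1) ∧ (∀ p, p ≤ j → 1 - ∑ l ∈ range N, K p l ≤ v p) := by
  have hv1 : ∀ n, v n ≤ 1 := fun n => by
    have hR0 : 0 ≤ R v n := read_nonneg hR hK fun m _ => hv0 m
    have hw : (if n ≤ j then (1:ℝ) else 0) ≤ 1 := by split_ifs <;> norm_num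
    rw [hrec n]; linarith
  refine ⟨hv1, fun p hp => ?_⟩
  have hle : R v p ≤ R (fun _ => (1:ℝ)) p := read_le_read hR hK fun m _ => hv1 m
  have heq : R (fun _ => (1:ℝ)) p = ∑ l ∈ range N, K p l := by rw [hR]; exact sum_congr rfl fun l _ => mul_one _
  rw [hrec p, if_pos hp]; linarith

end Summit.QuantumFields.BalabanUV.Beta.EriceRemainderEnclosureHistoryAutonomyComparisonAgeCompositionEnteringLagLevelsSup

end
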